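import Summits.CriticalPhenomena.Ising3DConformalLimit.Theorems.InverseSquareTelemetryEtaBoundsFromTelemetry
import HarnessLib

/-!
# Crux `PositiveSolutionAsymptotics` (stmt-CriticalPhenomena-4496), stub S3: the two-annulus squeeze

THEOREM-ONLY file (no definitions, no named facts), `--supports stmt-CriticalPhenomena-4496`.
`stub_annulusSqueeze` is stub S3 of the birth skeleton of crux
`…Theses.InverseSquareTelemetry.PositiveSolutionAsymptotics` (lattice Agmon–Murata–Pinchover
asymptotics): for a positive solution `u` of `Δ_{ℤ³} u = V u` on `{|x|₂ ≥ R}` with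
`| |x|₂² V(x) - κ | ≤ C |x|₂^{-ε}` (`κ ≥ 0`, `ε > 0`), bounds `c₁ ≤ q ≤ c₂ ≤ B` (`q = u |x|₂^{α₊}`,
`α₊ = (1 + √(1+4κ))/2`) on the annuli `{ρ ≤ |x|₂ ≤ 2ρ}`, `{ρ' ≤ |x|₂ ≤ 2ρ'}` (`ρ' ≥ 4ρ ≥ 4ρ₁(B, δ)`)
propagate, up to `δ`, to `{2ρ ≤ |x|₂ ≤ ρ'}`; no decay hypothesis on `u` (the comparison runs on the
FINITE set `D = {2ρ < |x|₂ < ρ'}`).  Proof = the comparison steps of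
`EtaBoundsFromTelemetry.exterior_bounds` on `D`: `s = ∑ xᵢ²`, `p = α₊/2`, barriers
`w± = s^{-p} ∓ A s^{-p-e'}` (`barrier_arith`), weight `h = s^{-1/4}` (`weight_arith`),
`sub_le_super_of_hTransform` on `D` (finite: `finite_sumSq_le`); `∂D` lies in the two annuli
(`√s(x) - 1 ≤ √s(x ± eᵢ) ≤ √s(x) + 1`), where `c₁ s^{-p} ≤ u ≤ c₂ s^{-p}`; with `A s^{-e'} ≤ η`,
`η(|B| + δ) = δ/2`, comparison with `(c₂/(1-η)) w₊` and `(max c₁ 0/(1+η)) w₋` gives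
`c₁ - δ ≤ q ≤ c₂ + δ` on `D`; the lattice point `(⌈ρ⌉, 0, 0)` gives `0 < c₂`, `c₁ ≤ c₂ ≤ B`.
-/
noncomputable section

namespace Summit.CriticalPhenomena.Ising3DConformalLimit.Theorems.PositiveSolutionAsymptotics

open Literature.Probability.LatticeModels Finset Set Filter Topology
open Summit.CriticalPhenomena.Ising3DConformalLimit.Theorems.EtaBoundsFromTelemetry

/-- **The nearest-neighbour shell.** `√s(x) - 1 ≤ √s(x ± eᵢ) ≤ √s(x) + 1` on `ℤ³`
(`s = ∑ xⱼ²`, `s(x ± eᵢ) = s(x) + (1 ± 2xᵢ)` and `|xᵢ| ≤ √s(x)`). [folklore] -/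
theorem sqrt_sumSq_neighbor (x : Site 3) (i : Fin 3) :
    (Real.sqrt (∑ j, ((x j : ℤ) : ℝ) ^ 2) - 1 ≤
        Real.sqrt (∑ j, (((x + Pi.single i 1 : Site 3) j : ℤ) : ℝ) ^ 2) ∧
      Real.sqrt (∑ j, (((x + Pi.single i 1 : Site 3) j : ℤ) : ℝ) ^ 2) ≤
        Real.sqrt (∑ j, ((x j : ℤ) : ℝ) ^ 2) + 1) ∧
    (Real.sqrt (∑ j, ((x j : ℤ) : ℝ) ^ 2) - 1 ≤
        Real.sqrt (∑ j, (((x - Pi.single i 1 : Site 3) j : ℤ) : ℝ) ^ 2) ∧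
      Real.sqrt (∑ j, (((x - Pi.single i 1 : Site 3) j : ℤ) : ℝ) ^ 2) ≤
        Real.sqrt (∑ j, ((x j : ℤ) : ℝ) ^ 2) + 1) := by
  have hadd : (∑ j, (((x + Pi.single i 1 : Site 3) j : ℤ) : ℝ) ^ 2) =
      (∑ j, ((x j : ℤ) : ℝ) ^ 2) + (2 * ((x i : ℤ) : ℝ) + 1) := by
    fin_cases i <;> simp [Fin.sum_univ_three] <;> ring
  have hsub : (∑ j, (((x - Pi.single i 1 : Site 3) j : ℤ) : ℝ) ^ 2) =
      (∑ j, ((x j : ℤ) : ℝ) ^ 2) + (2 * (-((x i : ℤ) : ℝ)) + 1) := by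
    fin_cases i <;> simp [Fin.sum_univ_three] <;> ring
  have has : ((x i : ℤ) : ℝ) ^ 2 ≤ ∑ j, ((x j : ℤ) : ℝ) ^ 2 := sq_apply_le_sumSq x i
  rw [hadd, hsub]
  set s : ℝ := ∑ j, ((x j : ℤ) : ℝ) ^ 2 with hs
  set a : ℝ := ((x i : ℤ) : ℝ) with ha
  have hs0 : 0 ≤ s := by rw [hs]; positivity
  obtain ⟨ha1, ha2⟩ := (Real.sq_le hs0).1 has
  have ht0 : 0 ≤ Real.sqrt s := Real.sqrt_nonneg _
  have hts : Real.sqrt s ^ 2 = s := Real.sq_sqrt hs0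
  have key : ∀ b : ℝ, -Real.sqrt s ≤ b → b ≤ Real.sqrt s →
      Real.sqrt s - 1 ≤ Real.sqrt (s + (2 * b + 1)) ∧
        Real.sqrt (s + (2 * b + 1)) ≤ Real.sqrt s + 1 := by
    intro b hb1 hb2
    constructor
    · have h1 : (Real.sqrt s - 1) ^ 2 ≤ s + (2 * b + 1) := by nlinarith
      calc Real.sqrt s - 1 ≤ |Real.sqrt s - 1| := le_abs_self _
        _ = Real.sqrt ((Real.sqrt s - 1) ^ 2) := (Real.sqrt_sq_eq_abs _).symm
        _ ≤ Real.sqrt (s + (2 * b + 1)) := Real.sqrt_le_sqrt h1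
    · rw [Real.sqrt_le_left (by linarith)]
      nlinarith
  exact ⟨key a ha1 ha2, key (-a) (by linarith) (by linarith)⟩

/-- **S3 (two-annulus squeeze)** of crux `PositiveSolutionAsymptotics`. For a positive solution `u`
of `Δ_{ℤ³} u = V u` on `{|x|₂ ≥ R}` with `| |x|₂² V - κ | ≤ C |x|₂^{-ε}` (`κ ≥ 0`, `ε > 0`): for all
`B` and `δ > 0` there is `ρ₁` such that bounds `c₁ ≤ q ≤ c₂ ≤ B` (`q = u |x|₂^{α₊}`,
`α₊ = (1 + √(1+4κ))/2`) on two annuli `{ρ ≤ |x|₂ ≤ 2ρ}` and `{ρ' ≤ |x|₂ ≤ 2ρ'}` with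
`ρ₁ ≤ ρ`, `4ρ ≤ ρ'` give `c₁ - δ ≤ q ≤ c₂ + δ` on `{2ρ ≤ |x|₂ ≤ ρ'}`: comparison of `u` with
`(c₂/(1-η)) |x|₂^{-α₊}(1 - A|x|₂^{-e'})` (supersolution) and
`(max c₁ 0/(1+η)) |x|₂^{-α₊}(1 + A|x|₂^{-e'})` (subsolution) on the finite set `{2ρ < |x|₂ < ρ'}`
by the `h`-transform comparison principle `sub_le_super_of_hTransform` (`h = |x|₂^{-1/2}`), whose
outer lattice boundary lies in the two annuli; no decay hypothesis is needed. [folklore] -/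
theorem stub_annulusSqueeze :
    ∀ κ ε C : ℝ, 0 ≤ κ → 0 < ε → ∀ (u V : Literature.Probability.LatticeModels.Site 3 → ℝ) (R : ℝ), (∀ x : Literature.Probability.LatticeModels.Site 3, R ≤ Real.sqrt (∑ i, ((x i : ℝ)) ^ 2) → 0 < u x) → (∀ x : Literature.Probability.LatticeModels.Site 3, R ≤ Real.sqrt (∑ i, ((x i : ℝ)) ^ 2) → (∑ i : Fin 3, (u (x + Pi.single i 1) + u (x - Pi.single i 1))) - 6 * u x = V x * u x) → (∀ x : Literature.Probability.LatticeModels.Site 3, R ≤ Real.sqrt (∑ i, ((x i : ℝ)) ^ 2) → |(∑ i, ((x i : ℝ)) ^ 2) * V x - κ| ≤ C * Real.sqrt (∑ i, ((x i : ℝ)) ^ 2) ^ (-ε)) → ∀ B δ : ℝ, 0 < δ → ∃ ρ₁ : ℝ, ∀ ρ ρ' c₁ c₂ : ℝ, ρ₁ ≤ ρ → 4 * ρ ≤ ρ' → c₂ ≤ B → (∀ x : Literature.Probability.LatticeModels.Site 3, (ρ ≤ Real.sqrt (∑ i, ((x i : ℝ)) ^ 2) ∧ Real.sqrt (∑ i,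 ((x i : ℝ)) ^ 2) ≤ 2 * ρ) ∨ (ρ' ≤ Real.sqrt (∑ i, ((x i : ℝ)) ^ 2) ∧ Real.sqrt (∑ i, ((x i : ℝ)) ^ 2) ≤ 2 * ρ') → c₁ ≤ u x * Real.sqrt (∑ i, ((x i : ℝ)) ^ 2) ^ ((1 + Real.sqrt (1 + 4 * κ)) / 2) ∧ u x * Real.sqrt (∑ i, ((x i : ℝ)) ^ 2) ^ ((1 + Real.sqrt (1 + 4 * κ)) / 2) ≤ c₂) → ∀ x : Literature.Probability.LatticeModels.Site 3, 2 * ρ ≤ Real.sqrt (∑ i, ((x i : ℝ)) ^ 2) → Real.sqrt (∑ i, ((x i : ℝ)) ^ 2) ≤ ρ' → c₁ - δ ≤ u x * Real.sqrt (∑ i, ((x i : ℝ)) ^ 2) ^ ((1 + Real.sqrt (1 + 4 * κ)) / 2) ∧ u x * Real.sqrt (∑ i, ((x i : ℝ)) ^ 2) ^ ((1 + Real.sqrt (1 + 4 * κ)) / 2) ≤ c₂ + δ := by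
  intro κ ε C hκ hε u V R hupos heq hV B δ hδ
  obtain ⟨S, hS⟩ : ∃ S : Site 3 → ℝ, ∀ x, S x = ∑ i, ((x i : ℤ) : ℝ) ^ 2 := ⟨_, fun _ => rfl⟩
  simp only [← hS] at hupos heq hV ⊢
  have hSnn : ∀ x, 0 ≤ S x := fun x => by rw [hS]; positivity
  -- the exponents `p = α₊/2`, `e = ε/2`, and the constant `C' = max C 0`
  set r : ℝ := Real.sqrt (1 + 4 * κ) with hr
  have hr1 : 1 ≤ r := by
    simpa only [Real.sqrt_one] using Real.sqrt_le_sqrt (show (1 : ℝ) ≤ 1 + 4 * κ by linarith)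
  have hrr : r ^ 2 = 1 + 4 * κ := Real.sq_sqrt (by linarith)
  set p : ℝ := (1 + r) / 4 with hp
  have hp2 : 1 / 2 ≤ p := by rw [hp]; linarith
  have hp0 : 0 < p := by linarith
  have hκp : 2 * p * (2 * p - 1) = κ := by rw [hp]; linear_combination (1 / 4 : ℝ) * hrr
  have hq : ∀ y : Site 3, Real.sqrt (S y) ^ ((1 + r) / 2) = S y ^ p := fun y => by
    rw [Real.sqrt_eq_rpow, ← Real.rpow_mul (hSnn y), hp]; congr 1; ring
  set e : ℝ := ε / 2 with he_def
  have he : 0 < e := by rw [he_def]; positivity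
  set C' : ℝ := max C 0 with hC'_def
  have hC' : 0 ≤ C' := le_max_right _ _
  have hsol : ∀ x, R ≤ Real.sqrt (S x) → latticeLaplacianZd u x = V x * u x := fun x hx => by
    rw [latticeLaplacianZd_three]; exact heq x hx
  have hVT : ∀ x, R ≤ Real.sqrt (S x) → |S x * V x - κ| ≤ C' * S x ^ (-e) := fun x hx => by
    have h := hV x hx
    have e2 : Real.sqrt (S x) ^ (-ε) = S x ^ (-e) := by
      rw [Real.sqrt_eq_rpow, ← Real.rpow_mul (hSnn x), he_def]; congr 1; ring
    rw [e2] at h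
    exact h.trans (mul_le_mul_of_nonneg_right (le_max_left _ _) (Real.rpow_nonneg (hSnn x) _))
  clear heq hV
  -- the barrier parameters, as in `EtaBoundsFromTelemetry.exterior_bounds`
  set e' : ℝ := min e (1 / 4) / 2 with he'
  have he'0 : 0 < e' := by rw [he']; positivity
  have he'e : e' < e := by rw [he']; linarith [min_le_left e (1 / 4)]
  have he'4 : e' ≤ 1 / 8 := by rw [he']; linarith [min_le_right e (1 / 4)]
  set D₀ : ℝ := 2 * e' * (4 * p + 2 * e' - 1) with hD₀
  have hD₀0 : 0 < D₀ := by rw [hD₀]; exact mul_pos (mul_pos two_pos he'0) (by linarith)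
  have hκq : 2 * (p + e') * (2 * (p + e') - 1) = κ + D₀ := by rw [hD₀, ← hκp]; ring
  obtain ⟨Kp, hKp0, hLp⟩ := latticeLaplacianZd_rpow_neg hp0
  obtain ⟨Kq, hKq0, hLq⟩ := latticeLaplacianZd_rpow_neg (show 0 < p + e' by linarith)
  obtain ⟨Kh, hKh0, hLh⟩ := latticeLaplacianZd_rpow_neg (show (0 : ℝ) < 1 / 4 by norm_num)
  simp only [← hS] at hLp hLq hLh
  simp only [hκq] at hLq
  simp only [hκp] at hLp
  set A : ℝ := 4 * (C' + Kp + 1) / D₀ with hA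
  have hA0 : 0 < A := by rw [hA]; positivity
  have hAD : A * D₀ = 4 * (C' + Kp + 1) := by rw [hA]; field_simp
  -- the accuracy `η`: `0 < η ≤ 1/2`, `η (|B| + δ) = δ/2`
  set η : ℝ := δ / (2 * (|B| + δ)) with hη
  have hBδ : 0 < |B| + δ := by positivity
  have hη0 : 0 < η := by rw [hη]; positivity
  have hηB : η * |B| + η * δ = δ / 2 := by rw [hη]; field_simp
  have hη2 : η ≤ 1 / 2 := by
    rw [hη, div_le_iff₀ (by positivity)]; linarith [abs_nonneg B]
  -- thresholds
  have hev : ∀ᶠ s : ℝ in atTop, 16 ≤ s ∧ (A * Kq * s ^ (-(1 / 2 : ℝ)) ≤ 1 ∧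
      (C' * A * s ^ (-e) ≤ 1 ∧ (Kh * s ^ (-(1 / 2 : ℝ)) ≤ 1 / 8 ∧
      (C' * s ^ (-e) ≤ 1 / 8 ∧ A * s ^ (-e') ≤ η)))) :=
    (eventually_ge_atTop 16).and ((eventually_mul_rpow_neg_le (by norm_num) _ one_pos).and
      ((eventually_mul_rpow_neg_le he _ one_pos).and
      ((eventually_mul_rpow_neg_le (by norm_num) _ (by norm_num)).and
      ((eventually_mul_rpow_neg_le he _ (by norm_num)).and
      (eventually_mul_rpow_neg_le he'0 _ hη0)))))
  obtain ⟨S₁, hS₁⟩ := Filter.eventually_atTop.1 hev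
  clear_value A D₀ e' p r e C' η
  clear hev hA hD₀ he' hp hr hrr he_def hC'_def hη
  refine ⟨max (max R 1) S₁, ?_⟩
  intro ρ ρ' c₁ c₂ hρ₁ hρ' hc₂B hann x hx₁ hx₂
  simp only [hq] at hann ⊢
  have hρ1 : 1 ≤ ρ := le_trans (le_trans (le_max_right _ _) (le_max_left _ _)) hρ₁
  have hρR : R ≤ ρ := le_trans (le_trans (le_max_left _ _) (le_max_left _ _)) hρ₁
  have hρS₁ : S₁ ≤ ρ ^ 2 :=
    (le_trans (le_max_right _ _) hρ₁).trans (le_self_pow₀ hρ1 two_ne_zero)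
  -- admissible points `ρ ≤ √s`: the equation and the telemetry bound hold, and all thresholds
  have adm : ∀ y : Site 3, ρ ≤ Real.sqrt (S y) → R ≤ Real.sqrt (S y) ∧ 1 ≤ S y ∧ 16 ≤ S y ∧
      A * S y ^ (-(p + e')) ≤ η * S y ^ (-p) ∧ A ≤ S y ^ e' ∧
      A * Kq * S y ^ (-(1 / 2 : ℝ)) ≤ 1 ∧ C' * A * S y ^ (-e) ≤ 1 ∧
      Kh * S y ^ (-(1 / 2 : ℝ)) ≤ 1 / 8 ∧ C' * S y ^ (-e) ≤ 1 / 8 := by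
    intro y hy
    have hSy : ρ ^ 2 ≤ S y := (Real.le_sqrt' (by linarith)).1 hy
    obtain ⟨h16, h1, h2, h3, h4, h5⟩ := hS₁ (S y) (hρS₁.trans hSy)
    have hs0 : 0 < S y := by linarith
    have hρ2 : (1 : ℝ) ≤ ρ ^ 2 := one_le_pow₀ hρ1
    refine ⟨hρR.trans hy, hρ2.trans hSy, h16, ?_, ?_, h1, h2, h3, h4⟩
    · have hsplit : S y ^ (-(p + e')) = S y ^ (-e') * S y ^ (-p) := by
        rw [← Real.rpow_add hs0]; congr 1; ring
      rw [hsplit, ← mul_assoc]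
      exact mul_le_mul_of_nonneg_right h5 (Real.rpow_nonneg hs0.le _)
    · have hinv : S y ^ (-e') = (S y ^ e')⁻¹ := Real.rpow_neg hs0.le e'
      have hpos : 0 < S y ^ e' := Real.rpow_pos_of_pos hs0 _
      rw [hinv, ← div_eq_mul_inv, div_le_iff₀ hpos] at h5
      calc A ≤ η * S y ^ e' := h5
        _ ≤ 1 * S y ^ e' := mul_le_mul_of_nonneg_right (by linarith) hpos.le
        _ = S y ^ e' := one_mul _
  -- a lattice point `(⌈ρ⌉, 0, 0)` in the first annulus: `c₁ ≤ c₂` and `0 < c₂`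
  obtain ⟨hc₁₂, hc₂0⟩ : c₁ ≤ c₂ ∧ 0 < c₂ := by
    have hn1 : ρ ≤ ((⌈ρ⌉ : ℤ) : ℝ) := Int.le_ceil ρ
    have hn2 : ((⌈ρ⌉ : ℤ) : ℝ) < ρ + 1 := Int.ceil_lt_add_one ρ
    have hn0 : (0 : ℝ) ≤ ((⌈ρ⌉ : ℤ) : ℝ) := by linarith
    obtain ⟨x₀, hx₀⟩ : ∃ x₀ : Site 3, x₀ = Pi.single (0 : Fin 3) ⌈ρ⌉ := ⟨_, rfl⟩
    have hSx₀ : S x₀ = ((⌈ρ⌉ : ℤ) : ℝ) ^ 2 := by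
      rw [hS, hx₀]; simp [Fin.sum_univ_three]
    have hsq : Real.sqrt (S x₀) = ((⌈ρ⌉ : ℤ) : ℝ) := by rw [hSx₀, Real.sqrt_sq hn0]
    have h := hann x₀ (Or.inl ⟨by rw [hsq]; exact hn1, by rw [hsq]; linarith⟩)
    have hu0 : 0 < u x₀ := hupos x₀ (by rw [hsq]; linarith)
    have hq0 : 0 < u x₀ * S x₀ ^ p :=
      mul_pos hu0 (Real.rpow_pos_of_pos (by rw [hSx₀]; exact pow_pos (by linarith) 2) _)
    exact ⟨h.1.trans h.2, hq0.trans_le h.2⟩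
  have hc₁B : c₁ ≤ |B| := hc₁₂.trans (hc₂B.trans (le_abs_self B))
  have hc₂B' : c₂ ≤ |B| := hc₂B.trans (le_abs_self B)
  -- the finite region `D = {2ρ < √s < ρ'}`; its outer boundary lies in the two annuli
  obtain ⟨D, hDmem⟩ : ∃ D : Set (Site 3), ∀ y, y ∈ D ↔
      2 * ρ < Real.sqrt (S y) ∧ Real.sqrt (S y) < ρ' :=
    ⟨{y | 2 * ρ < Real.sqrt (S y) ∧ Real.sqrt (S y) < ρ'}, fun _ => Iff.rfl⟩
  have hDF : D.Finite := by
    have hF : {y : Site 3 | S y ≤ ρ' ^ 2}.Finite := by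
      simpa only [← hS] using finite_sumSq_le (ρ' ^ 2)
    refine hF.subset fun y hy => ?_
    obtain ⟨-, hy2⟩ := (hDmem y).1 hy
    have h := pow_le_pow_left₀ (Real.sqrt_nonneg (S y)) hy2.le 2
    rw [Real.sq_sqrt (hSnn y)] at h
    exact h
  have hbdry : ∀ y ∈ zdOuterBoundary D, (ρ ≤ Real.sqrt (S y) ∧ Real.sqrt (S y) ≤ 2 * ρ) ∨
      (ρ' ≤ Real.sqrt (S y) ∧ Real.sqrt (S y) ≤ 2 * ρ') := by
    rintro y ⟨hyD, z, hz, i, hzy⟩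
    rw [hDmem] at hyD hz
    obtain ⟨hlo, hhi⟩ : Real.sqrt (S z) - 1 ≤ Real.sqrt (S y) ∧
        Real.sqrt (S y) ≤ Real.sqrt (S z) + 1 := by
      have h := sqrt_sumSq_neighbor z i
      simp only [← hS] at h
      rcases hzy with rfl | rfl
      · exact h.1
      · exact h.2
    by_cases h1 : Real.sqrt (S y) ≤ 2 * ρ
    · exact Or.inl ⟨by linarith [hz.1], h1⟩
    · push Not at h1
      have h2 : ρ' ≤ Real.sqrt (S y) := by
        by_contra h3
        exact hyD ⟨h1, not_le.1 h3⟩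
      exact Or.inr ⟨h2, by linarith [hz.2]⟩
  have hDρ : ∀ y ∈ D ∪ zdOuterBoundary D, ρ ≤ Real.sqrt (S y) := by
    intro y hy
    rcases hy with hy | hy
    · have h := ((hDmem y).1 hy).1
      linarith
    · rcases hbdry y hy with ⟨h, -⟩ | ⟨h, -⟩
      · exact h
      · linarith
  -- (1) the weight `h = s^{-1/4}` is a positive supersolution on `D`
  have hpos : ∀ y ∈ D ∪ zdOuterBoundary D, 0 < (fun y => S y ^ (-(1 / 4 : ℝ))) y := by
    intro y hy
    have : 0 < S y := by linarith [(adm y (hDρ y hy)).2.1]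
    exact Real.rpow_pos_of_pos this _
  have hsuper : ∀ y ∈ D, latticeLaplacianZd (fun y => S y ^ (-(1 / 4 : ℝ))) y ≤
      V y * (fun y => S y ^ (-(1 / 4 : ℝ))) y := by
    intro y hy
    obtain ⟨hyR, hs1, hs16, -, -, -, -, c3, c4⟩ := adm y (hDρ y (Or.inl hy))
    exact weight_arith hs1 hκ (hLh y hs16) (hVT y hyR) (by linarith)
  -- (2) the barriers `w± = s^{-p} ∓ A s^{-p-e'}` on `D`
  have hbar : ∀ y ∈ D,
      latticeLaplacianZd (fun y => S y ^ (-p) - A * S y ^ (-(p + e'))) y ≤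
          V y * (S y ^ (-p) - A * S y ^ (-(p + e'))) ∧
        V y * (S y ^ (-p) + A * S y ^ (-(p + e'))) ≤
          latticeLaplacianZd (fun y => S y ^ (-p) + A * S y ^ (-(p + e'))) y := by
    intro y hy
    obtain ⟨hyR, hs1, hs16, -, hAu, c1, c2, -, -⟩ := adm y (hDρ y (Or.inl hy))
    obtain ⟨hsub, hadd⟩ := latticeLaplacianZd_sub_const_mul (fun y => S y ^ (-p))
      (fun y => S y ^ (-(p + e'))) A y
    rw [hsub, hadd]
    refine barrier_arith hs1 hA0.le hC' hAu (hLp y hs16) (hLq y hs16) (hVT y hyR) ?_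
    have h1 : S y ^ (e' - 1 / 2) ≤ 1 := Real.rpow_le_one_of_one_le_of_nonpos hs1 (by linarith)
    have h2 : S y ^ (e' - e) ≤ 1 := Real.rpow_le_one_of_one_le_of_nonpos hs1 (by linarith)
    have h3 : Kp * S y ^ (e' - 1 / 2) ≤ Kp := mul_le_of_le_one_right hKp0 h1
    have h4 : C' * S y ^ (e' - e) ≤ C' := mul_le_of_le_one_right hC' h2
    linarith
  have hwpos : ∀ y : Site 3, ρ ≤ Real.sqrt (S y) →
      0 < S y ^ (-p) ∧ 0 ≤ A * S y ^ (-(p + e')) ∧ A * S y ^ (-(p + e')) ≤ η * S y ^ (-p) := by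
    intro y hy
    obtain ⟨-, hs1, -, hAq, -⟩ := adm y hy
    have hs0 : 0 < S y := by linarith
    exact ⟨Real.rpow_pos_of_pos hs0 _, mul_nonneg hA0.le (Real.rpow_nonneg hs0.le _), hAq⟩
  -- boundary values: `c₁ s^{-p} ≤ u ≤ c₂ s^{-p}` on `∂D ⊆` the two annuli
  have hbv : ∀ y ∈ zdOuterBoundary D, ρ ≤ Real.sqrt (S y) ∧
      c₁ * S y ^ (-p) ≤ u y ∧ u y ≤ c₂ * S y ^ (-p) := by
    intro y hy
    have hyρ := hDρ y (Or.inr hy)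
    obtain ⟨h1, h2⟩ := hann y (hbdry y hy)
    have hs0 : 0 < S y := by linarith [(adm y hyρ).2.1]
    have hpp : S y ^ p * S y ^ (-p) = 1 := by
      rw [← Real.rpow_add hs0, add_neg_cancel, Real.rpow_zero]
    have hu : u y = u y * S y ^ p * S y ^ (-p) := by rw [mul_assoc, hpp, mul_one]
    have hn : 0 ≤ S y ^ (-p) := Real.rpow_nonneg hs0.le _
    refine ⟨hyρ, ?_, ?_⟩
    · rw [hu]; exact mul_le_mul_of_nonneg_right h1 hn
    · rw [hu]; exact mul_le_mul_of_nonneg_right h2 hn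
  -- (3) upper comparison: `u ≤ M₁ w₊` on `D`, `M₁ = c₂ / (1 - η)`
  obtain ⟨M₁, hM₁⟩ : ∃ M₁ : ℝ, M₁ = c₂ / (1 - η) := ⟨_, rfl⟩
  have h1η : 0 < 1 - η := by linarith
  have hM₁0 : 0 ≤ M₁ := by rw [hM₁]; exact div_nonneg hc₂0.le h1η.le
  have hM₁η : M₁ * (1 - η) = c₂ := by rw [hM₁]; field_simp
  have hupper : ∀ y ∈ D, u y ≤ M₁ * (S y ^ (-p) - A * S y ^ (-(p + e'))) := by
    refine sub_le_super_of_hTransform (d := 3) (by norm_num) (E := D) (V := V) (u := u)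
      (w := fun y => M₁ * (S y ^ (-p) - A * S y ^ (-(p + e'))))
      (h := fun y => S y ^ (-(1 / 4 : ℝ))) hpos hsuper ?_ ?_ ?_ ?_
    · intro y hy
      rw [hsol y (adm y (hDρ y (Or.inl hy))).1]
    · intro y hy
      rw [latticeLaplacianZd_const_mul]
      have h := (hbar y hy).1
      calc M₁ * latticeLaplacianZd (fun y => S y ^ (-p) - A * S y ^ (-(p + e'))) y
          ≤ M₁ * (V y * (S y ^ (-p) - A * S y ^ (-(p + e')))) := mul_le_mul_of_nonneg_left h hM₁0
        _ = V y * (M₁ * (S y ^ (-p) - A * S y ^ (-(p + e')))) := by ring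
    · intro y hy
      obtain ⟨hyρ, -, hu2⟩ := hbv y hy
      obtain ⟨h0, h1, h2⟩ := hwpos y hyρ
      calc u y ≤ c₂ * S y ^ (-p) := hu2
        _ = M₁ * ((1 - η) * S y ^ (-p)) := by rw [← mul_assoc, hM₁η]
        _ ≤ M₁ * (S y ^ (-p) - A * S y ^ (-(p + e'))) :=
            mul_le_mul_of_nonneg_left (by linarith) hM₁0
    · intro ε₁ _
      exact (show ∀ᶠ y in cofinite, y ∉ D from hDF.compl_mem_cofinite).mono
        fun _ hy hyD => (hy hyD).elim
  -- (4) lower comparison: `m₁ w₋ ≤ u` on `D`, `m₁ = max c₁ 0 / (1 + η)`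
  obtain ⟨m₁, hm₁⟩ : ∃ m₁ : ℝ, m₁ = max c₁ 0 / (1 + η) := ⟨_, rfl⟩
  have hm₁0 : 0 ≤ m₁ := by rw [hm₁]; exact div_nonneg (le_max_right _ _) (by linarith)
  have hm₁η : m₁ * (1 + η) = max c₁ 0 := by rw [hm₁]; field_simp
  have hlower : ∀ y ∈ D, m₁ * (S y ^ (-p) + A * S y ^ (-(p + e'))) ≤ u y := by
    refine sub_le_super_of_hTransform (d := 3) (by norm_num) (E := D) (V := V)
      (u := fun y => m₁ * (S y ^ (-p) + A * S y ^ (-(p + e')))) (w := u)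
      (h := fun y => S y ^ (-(1 / 4 : ℝ))) hpos hsuper ?_ ?_ ?_ ?_
    · intro y hy
      rw [latticeLaplacianZd_const_mul]
      have h := (hbar y hy).2
      calc V y * (m₁ * (S y ^ (-p) + A * S y ^ (-(p + e'))))
          = m₁ * (V y * (S y ^ (-p) + A * S y ^ (-(p + e')))) := by ring
        _ ≤ m₁ * latticeLaplacianZd (fun y => S y ^ (-p) + A * S y ^ (-(p + e'))) y :=
            mul_le_mul_of_nonneg_left h hm₁0
    · intro y hy
      rw [hsol y (adm y (hDρ y (Or.inl hy))).1]
    · intro y hy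
      obtain ⟨hyρ, hu1, -⟩ := hbv y hy
      obtain ⟨h0, h1, h2⟩ := hwpos y hyρ
      have huy : 0 < u y := hupos y (adm y hyρ).1
      have hmax : max c₁ 0 * S y ^ (-p) ≤ u y := by
        rcases le_total c₁ 0 with hc | hc
        · rw [max_eq_right hc, zero_mul]; exact huy.le
        · rw [max_eq_left hc]; exact hu1
      calc m₁ * (S y ^ (-p) + A * S y ^ (-(p + e')))
          ≤ m₁ * ((1 + η) * S y ^ (-p)) := mul_le_mul_of_nonneg_left (by linarith) hm₁0
        _ = max c₁ 0 * S y ^ (-p) := by rw [← mul_assoc, hm₁η]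
        _ ≤ u y := hmax
    · intro ε₁ _
      exact (show ∀ᶠ y in cofinite, y ∉ D from hDF.compl_mem_cofinite).mono
        fun _ hy hyD => (hy hyD).elim
  -- (5) conclusion at the point `x`
  have hxρ : ρ ≤ Real.sqrt (S x) := by linarith
  obtain ⟨hxR, hSx1, -⟩ := adm x hxρ
  have hSx0 : 0 < S x := by linarith
  have hux : 0 < u x := hupos x hxR
  have hSp : 0 < S x ^ p := Real.rpow_pos_of_pos hSx0 _
  have hqx : 0 < u x * S x ^ p := mul_pos hux hSp
  by_cases hxD : x ∈ D
  · have hpp : S x ^ (-p) * S x ^ p = 1 := by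
      rw [← Real.rpow_add hSx0, neg_add_cancel, Real.rpow_zero]
    obtain ⟨h0, h1, h2⟩ := hwpos x hxρ
    constructor
    · -- lower bound: `c₁ - δ ≤ m₁ ≤ q x`
      have hl := hlower x hxD
      have h3 : m₁ * S x ^ (-p) ≤ u x :=
        le_trans (mul_le_mul_of_nonneg_left (by linarith) hm₁0) hl
      have hm₁q : m₁ ≤ u x * S x ^ p := by
        calc m₁ = m₁ * S x ^ (-p) * S x ^ p := by rw [mul_assoc, hpp, mul_one]
          _ ≤ u x * S x ^ p := mul_le_mul_of_nonneg_right h3 hSp.le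
      have hc₁m₁ : c₁ - δ ≤ m₁ := by
        rcases le_total c₁ 0 with hc | hc
        · linarith
        · rw [max_eq_left hc] at hm₁η
          have h6 : 0 ≤ m₁ * η := mul_nonneg hm₁0 hη0.le
          have hm₁c : m₁ ≤ c₁ := by linarith
          have h5 : m₁ * η ≤ c₁ * η := mul_le_mul_of_nonneg_right hm₁c hη0.le
          have h7 : c₁ * η ≤ |B| * η := mul_le_mul_of_nonneg_right hc₁B hη0.le
          have h8 : 0 ≤ η * δ := mul_nonneg hη0.le hδ.le
          linarith
      linarith
    · -- upper bound: `q x ≤ M₁ ≤ c₂ + δ`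
      have hu := hupper x hxD
      have h3 : u x ≤ M₁ * S x ^ (-p) :=
        hu.trans (mul_le_mul_of_nonneg_left (by linarith) hM₁0)
      have hM₁q : u x * S x ^ p ≤ M₁ := by
        calc u x * S x ^ p ≤ M₁ * S x ^ (-p) * S x ^ p := mul_le_mul_of_nonneg_right h3 hSp.le
          _ = M₁ := by rw [mul_assoc, hpp, mul_one]
      have hM₁c : M₁ ≤ c₂ + δ := by
        have h4 : M₁ * (1 / 2) ≤ M₁ * (1 - η) := mul_le_mul_of_nonneg_left (by linarith) hM₁0
        have hM₁2 : M₁ ≤ 2 * c₂ := by linarith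
        have h5 : M₁ * η ≤ 2 * c₂ * η := mul_le_mul_of_nonneg_right hM₁2 hη0.le
        have h7 : c₂ * η ≤ |B| * η := mul_le_mul_of_nonneg_right hc₂B' hη0.le
        have h8 : 0 ≤ η * δ := mul_nonneg hη0.le hδ.le
        linarith
      linarith
  · -- `x` lies on the edge of `D`, i.e. in one of the two annuli
    have hxann : (ρ ≤ Real.sqrt (S x) ∧ Real.sqrt (S x) ≤ 2 * ρ) ∨
        (ρ' ≤ Real.sqrt (S x) ∧ Real.sqrt (S x) ≤ 2 * ρ') := by
      rw [hDmem] at hxD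
      by_cases h1 : Real.sqrt (S x) ≤ 2 * ρ
      · exact Or.inl ⟨hxρ, h1⟩
      · push Not at h1
        have h2 : ρ' ≤ Real.sqrt (S x) := by
          by_contra h3
          exact hxD ⟨h1, not_le.1 h3⟩
        exact Or.inr ⟨h2, by linarith⟩
    obtain ⟨h1, h2⟩ := hann x hxann
    constructor <;> linarith

end Summit.CriticalPhenomena.Ising3DConformalLimit.Theorems.PositiveSolutionAsymptotics
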